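import Summits.CriticalPhenomena.CardyFormulaZ2.Theorems.CardyFlipRussoVoronoiHubFromSmirnovTupleProb
import Summits.CriticalPhenomena.CardyFormulaZ2.Theorems.CardyFlipRussoVoronoiHubFromSmirnovCocircularCrossRatio

/-!
# Stub `poisson_ae_noCocircularFour` of line `moebius-exact-delaunay-dilation-ward`
# (crux `VoronoiHubFromSmirnov`, stmt-CriticalPhenomena-6433)

ALMOST SURE GENERAL POSITION of the nuclei of Poisson–Voronoi percolation (I. Benjamini,
O. Schramm, *Conformal invariance of Voronoi percolation*, Comm. Math. Phys. 197 (1998), §2–§4: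
Voronoi vertices are trivalent, the Delaunay triangulation is well defined, planar duality holds):
for a Poisson point process `P` on `ℂ` whose σ-finite intensity `ν` is absolutely continuous with
respect to Lebesgue measure, almost surely NO four distinct points of the configuration are
cocircular or collinear,

`P {c | ∃ x : Fin 4 → ℂ injective, x i ∈ c, range x cospherical or collinear} = 0`.

Proof.
* By the landed characterisation `cocircular_iff_crossRatio_real` (four distinct points are
  cocircular or collinear iff their cross-ratio is real) the event is contained in
  `{c | some injective 4-tuple of points of c lies in S}` with the measurable set
  `S = {x | x injective ∧ Im CR(x 1, x 2, x 3, x 0) = 0}`,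
  `CR(a,b,c,d) = (a − c)(b − d)/((a − d)(b − c))`; the first-moment bound
  `poisson_exists_tuple_le_pi` (Benjamini–Schramm Lemma 5.2) reduces the claim to `ν^{⊗4}(S) = 0`.
* `ν^{⊗4}(S) = 0` by Tonelli, splitting off the coordinate `x 0 = d`
  (`measurePreserving_piFinSuccAbove`, `Measure.prod_apply_symm`): for fixed distinct
  `a, b, c = x 1, x 2, x 3` the section `{d | Im CR(a,b,c,d) = 0, d ∉ {a,b,c}}` lies on the
  circumcircle of `a, b, c` when these are not collinear (in-circle test
  `inCircle_iff_crossRatio_im`), and on the line through `a, b` when they are (affine normal form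
  of the cross-ratio, `ccr_crossRatio_eq` / `ccr_im_eq_zero_of_crossRatio`); circles
  (`Measure.addHaar_sphere`) and lines (`Measure.addHaar_submodule`) are Lebesgue-null, hence
  `ν`-null as `ν ≪ volume`.

No new definitions; tree facts and Mathlib only.
-/

noncomputable section

namespace Summit.CriticalPhenomena.CardyFormulaZ2.Cruxes.VoronoiHubFromSmirnov.MoebiusExactDelaunayDilationWard

open Set MeasureTheory
open Literature.Analysis.FunctionSpaces

/-! ### Plane geometry: null sections -/

/-- A straight line of `ℂ` is Lebesgue-null: for `a ≠ b` the points `d` with real affine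
coordinate `(d − a)/(b − a)` (the line through `a` and `b`) form a null set — a translate of the
kernel of the nonzero real-linear functional `z ↦ Im (z/(b − a))`, a strict real subspace
(`Measure.addHaar_submodule`). [folklore] -/
theorem gp_line_null {a b : ℂ} (hab : a ≠ b) :
    volume {d : ℂ | ((d - a) / (b - a)).im = 0} = 0 := by
  have hba : b - a ≠ 0 := sub_ne_zero.mpr (Ne.symm hab)
  let ℓ : ℂ →ₗ[ℝ] ℝ := Complex.imLm.comp (LinearMap.mulRight ℝ (b - a)⁻¹)
  have hℓ : ∀ z, ℓ z = (z / (b - a)).im := fun z => by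
    simp [ℓ, div_eq_mul_inv]
  have hker : LinearMap.ker ℓ ≠ ⊤ := by
    intro h
    have hmem : Complex.I * (b - a) ∈ LinearMap.ker ℓ := h ▸ Submodule.mem_top
    rw [LinearMap.mem_ker, hℓ, mul_div_cancel_right₀ _ hba, Complex.I_im] at hmem
    exact one_ne_zero hmem
  have hsub : {d : ℂ | ((d - a) / (b - a)).im = 0} ⊆
      (fun d => -a + d) ⁻¹' (LinearMap.ker ℓ : Set ℂ) := by
    intro d hd
    rw [Set.mem_preimage, SetLike.mem_coe, LinearMap.mem_ker, hℓ, neg_add_eq_sub]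
    exact hd
  refine measure_mono_null hsub ?_
  rw [measure_preimage_add]
  exact Measure.addHaar_submodule volume _ hker

/-- **Null sections of the real-cross-ratio locus.** For `a, b, c : ℂ` the set of `d` such that
`a, b, c, d` are pairwise distinct and `Im ((a − c)(b − d)/((a − d)(b − c))) = 0` is Lebesgue-null:
it is empty unless `a, b, c` are distinct, lies on the line through `a, b` if `a, b, c` are
collinear (affine normal form of the cross-ratio), and on the circumcircle of `a, b, c` otherwise
(in-circle test `inCircle_iff_crossRatio_im`); lines and circles are null. [folklore] -/
theorem gp_slice_null (a b c : ℂ) :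
    volume {d : ℂ | (a ≠ b ∧ a ≠ c ∧ b ≠ c ∧ a ≠ d ∧ b ≠ d ∧ c ≠ d) ∧
      ((a - c) * (b - d) / ((a - d) * (b - c))).im = 0} = 0 := by
  by_cases h3 : a ≠ b ∧ a ≠ c ∧ b ≠ c
  swap
  · exact measure_mono_null (fun d hd => (h3 ⟨hd.1.1, hd.1.2.1, hd.1.2.2.1⟩).elim) measure_empty
  obtain ⟨hab, hac, hbc⟩ := h3
  have hba : b - a ≠ 0 := sub_ne_zero.mpr (Ne.symm hab)
  by_cases hcol : Collinear ℝ ({a, b, c} : Set ℂ)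
  · -- collinear frame: `d` lies on the line through `a` and `b`
    refine measure_mono_null (fun d hd => ?_) (gp_line_null hab)
    obtain ⟨⟨-, -, -, had, -, -⟩, him⟩ := hd
    have hc : ((c - a) / (b - a)).im = 0 :=
      (ccr_collinear_iff (S := ({a, b, c} : Set ℂ)) (by simp) (by simp) hab).mp hcol c (by simp)
    have hlc0 : (c - a) / (b - a) ≠ 0 := div_ne_zero (sub_ne_zero.mpr (Ne.symm hac)) hba
    have hld0 : (d - a) / (b - a) ≠ 0 := div_ne_zero (sub_ne_zero.mpr (Ne.symm had)) hba
    have hlc1 : 1 - (c - a) / (b - a) ≠ 0 := by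
      rw [one_sub_div hba, sub_sub_sub_cancel_right]
      exact div_ne_zero (sub_ne_zero.mpr hbc) hba
    exact ccr_im_eq_zero_of_crossRatio (ccr_crossRatio_eq (c := c) (d := d) hab) hlc0 hlc1 hld0
      hc him
  · -- non-degenerate triangle: `d` lies on the circumcircle of `a, b, c`
    obtain ⟨o, R, ha, hb, hc⟩ := ccr_exists_circumcircle hcol
    refine measure_mono_null (fun d hd => ?_) (Measure.addHaar_sphere volume o R)
    exact Metric.mem_sphere.mpr
      ((inCircle_iff_crossRatio_im a b c d o R hab hbc hac ha hb hc).2.mpr hd.2)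

/-! ### The tuple set `S` -/

/-- A `4`-tuple enumerates its range: `range x = {x 1, x 2, x 3, x 0}`. [folklore] -/
theorem gp_range_eq (x : Fin 4 → ℂ) : Set.range x = {x 1, x 2, x 3, x 0} := by
  ext z
  simp only [Set.mem_range, Set.mem_insert_iff, Set.mem_singleton_iff]
  constructor
  · rintro ⟨i, rfl⟩
    fin_cases i
    · exact Or.inr (Or.inr (Or.inr rfl))
    · exact Or.inl rfl
    · exact Or.inr (Or.inl rfl)
    · exact Or.inr (Or.inr (Or.inl rfl))
  · rintro (rfl | rfl | rfl | rfl) <;> exact ⟨_, rfl⟩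

/-- The set `S = {x : ℂ⁴ | x injective ∧ Im CR(x 1, x 2, x 3, x 0) = 0}` of injective `4`-tuples
with real cross-ratio is measurable (injectivity is a finite Boolean combination of the closed
conditions `x i = x j`; the cross-ratio is a measurable function). [folklore] -/
theorem gp_measurableSet :
    MeasurableSet {x : Fin 4 → ℂ | Function.Injective x ∧
      ((x 1 - x 3) * (x 2 - x 0) / ((x 1 - x 0) * (x 2 - x 3))).im = 0} := by
  refine measurableSet_setOf.2 (Measurable.and ?_ ?_)
  · show Measurable fun x : Fin 4 → ℂ => ∀ i j, x i = x j → i = j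
    exact Measurable.forall fun i => Measurable.forall fun j =>
      ((measurable_pi_apply i).eq (measurable_pi_apply j)).imp measurable_const
  · exact Measurable.eq_const (by fun_prop) 0

/-- **`S` is `ν^{⊗4}`-null** for every σ-finite `ν ≪ volume`: Tonelli over the split
`ℂ⁴ ≃ ℂ × ℂ³` singling out the coordinate `x 0` (`measurePreserving_piFinSuccAbove`,
`Measure.prod_apply_symm`), each section being Lebesgue-null (`gp_slice_null`), hence `ν`-null.
[folklore] -/
theorem gp_pi_null {ν : MeasureTheory.Measure ℂ} [MeasureTheory.SigmaFinite ν]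
    (hν : ν ≪ (volume : Measure ℂ)) :
    Measure.pi (fun _ : Fin 4 => ν) {x : Fin 4 → ℂ | Function.Injective x ∧
      ((x 1 - x 3) * (x 2 - x 0) / ((x 1 - x 0) * (x 2 - x 3))).im = 0} = 0 := by
  set S : Set (Fin 4 → ℂ) := {x : Fin 4 → ℂ | Function.Injective x ∧
      ((x 1 - x 3) * (x 2 - x 0) / ((x 1 - x 0) * (x 2 - x 3))).im = 0}
  have hS : MeasurableSet S := gp_measurableSet
  set e := MeasurableEquiv.piFinSuccAbove (fun _ : Fin 4 => ℂ) 0 with he_def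
  have he : MeasurePreserving e (Measure.pi fun _ : Fin 4 => ν)
      (ν.prod (Measure.pi fun _ : Fin 3 => ν)) :=
    measurePreserving_piFinSuccAbove (fun _ : Fin 4 => ν) 0
  have hsymm : ∀ (d : ℂ) (y : Fin 3 → ℂ), e.symm (d, y) = Fin.cons d y := fun d y => by
    rw [he_def, MeasurableEquiv.piFinSuccAbove_symm_apply]
    exact Fin.insertNth_zero' d y
  rw [← (he.symm e).measure_preimage_equiv S,
    Measure.prod_apply_symm (hS.preimage e.symm.measurable)]
  refine (lintegral_congr fun y => ?_).trans lintegral_zero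
  -- the section at `y = (a, b, c)` is `ν`-null
  refine hν (measure_mono_null (fun d hd => ?_) (gp_slice_null (y 0) (y 1) (y 2)))
  have hd' : (Fin.cons d y : Fin 4 → ℂ) ∈ S := by
    rw [Set.mem_preimage, Set.mem_preimage, hsymm] at hd
    exact hd
  obtain ⟨hinj, him⟩ := hd'
  exact ⟨⟨hinj.ne (show (1 : Fin 4) ≠ 2 by decide), hinj.ne (show (1 : Fin 4) ≠ 3 by decide),
    hinj.ne (show (2 : Fin 4) ≠ 3 by decide), hinj.ne (show (1 : Fin 4) ≠ 0 by decide),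
    hinj.ne (show (2 : Fin 4) ≠ 0 by decide), hinj.ne (show (3 : Fin 4) ≠ 0 by decide)⟩, him⟩

/-! ### The stub -/

/-- **Almost sure general position (Benjamini–Schramm 1998, §2–§4 standing assumption).** For a
Poisson point process `P` on `ℂ` with σ-finite intensity `ν ≪ volume`, almost surely no four
distinct points of the configuration are cocircular or collinear: the event is contained in
"some injective `4`-tuple of points lies in `S`" (`cocircular_iff_crossRatio_real`), whose
probability is at most `ν^{⊗4}(S)` (`poisson_exists_tuple_le_pi`, BS98 Lemma 5.2), and
`ν^{⊗4}(S) = 0` (`gp_pi_null`). [folklore] -/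
theorem poisson_ae_noCocircularFour : ∀ {ν : MeasureTheory.Measure ℂ} [MeasureTheory.SigmaFinite ν] {P : MeasureTheory.Measure (Literature.Analysis.FunctionSpaces.PointConfig ℂ)}, Literature.Analysis.FunctionSpaces.IsPoissonPointProcess ν P → ν ≪ (MeasureTheory.volume : MeasureTheory.Measure ℂ) → P {c | ∃ x : Fin 4 → ℂ, Function.Injective x ∧ (∀ i, x i ∈ c) ∧ (EuclideanGeometry.Cospherical (Set.range x) ∨ Collinear ℝ (Set.range x))} = 0 := by
  intro ν _ P hP hν
  have hle := poisson_exists_tuple_le_pi hP 4 _ gp_measurableSet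
  have h0 := gp_pi_null hν
  refine measure_mono_null (fun c hc => ?_) (nonpos_iff_eq_zero.1 (hle.trans h0.le))
  obtain ⟨x, hx, hxc, hgeo⟩ := hc
  refine ⟨x, hx, hxc, hx, ?_⟩
  rw [gp_range_eq x] at hgeo
  exact (cocircular_iff_crossRatio_real (x 1) (x 2) (x 3) (x 0) (hx.ne (by decide))
    (hx.ne (by decide)) (hx.ne (by decide)) (hx.ne (by decide)) (hx.ne (by decide))
    (hx.ne (by decide))).mp hgeo

end Summit.CriticalPhenomena.CardyFormulaZ2.Cruxes.VoronoiHubFromSmirnov.MoebiusExactDelaunayDilationWard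

end
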